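import Literature.NumberTheory.CubicFields.VoronoiChain
import HarnessLib

/-!
# Rescaling and re-basing the Voronoi chain; labels of the cycle of reduced ideals

Topic `Literature/NumberTheory/CubicFields`; continues `VoronoiChain.lean` (a cubic number field `K`
with a real embedding `σ₁`, a non-real embedding `σ₂`, a fractional ideal `I` of `𝓞 K`, a unit `ε`
with `σ₁ ε > 1`). Elementary transport properties of Voronoi's relative minima and of the chain
`voronoiChain σ₁ σ₂ I x₀ : ℤ → K`, as used by the reduced-ideal-cycle ("infrastructure")
algorithms for complex cubic fields (Williams–Dueck–Schmid 1983 §3; Buchmann–Williams 1988 §2):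

* `mul_mem_relMinima`, `mul_mem_posRelMinima`, `inv_mul_mem_posRelMinima` — scaling by `c`
  (`σ₁ c > 0`) maps the (positive) relative minima of `I` onto those of `c I = spanSingleton c * I`;
  `one_mem_posRelMinima_inv_mul` — `1` is a positive minimum of the reduced ideal `μ⁻¹ I`;
* `voronoiSucc_mul`, `voronoiChain_mul` — the successor and the chain commute with scaling;
  `voronoiChain_rebase` — the chain through `θ i` is the shifted chain;
  `voronoiChain_inv_mul` — the chain of `(θ i)⁻¹ I` through `1` is `k ↦ (θ i)⁻¹ θ (i + k)`;
* `eq_zpow_mul_of_forall_apply_add` — a one-step period `θ (i + c) = u θ i` iterates to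
  `θ (i + k c) = u ^ k θ i` (`k : ℤ`);
* `spanSingleton_unit_mul`, `spanSingleton_inv_mul_eq_iff` — the labels `a⁻¹ I`, `b⁻¹ I`
  (`I ≠ 0`) coincide iff `b = u a` for a unit `u` of `𝓞 K`.

Not here: the big-gap filtering of the chain (`VoronoiChainFilter.lean`), unit classification.

## References

* H. C. Williams, G. W. Dueck, B. K. Schmid, *A rapid method of evaluating the regulator and class
  number of a pure cubic field*, Math. Comp. 41 (1983), §3.
* J. Buchmann, H. C. Williams, *On the infrastructure of the principal ideal class of an algebraic
  number field of unit rank one*, Math. Comp. 50 (1988), §2.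
-/

namespace Literature.NumberTheory.CubicFields

open scoped NumberField ComplexConjugate nonZeroDivisors
open NumberField

section Rescale

variable {K : Type*} [Field K] [NumberField K] {σ₁ : K →+* ℝ} {σ₂ : K →+* ℂ}
  {I : FractionalIdeal (nonZeroDivisors (𝓞 K)) K}

/-- **Scaling a relative minimum**: for `c ≠ 0`, `c θ` is a relative minimum of `c I` whenever
`θ` is one of `I` (the normed bodies are scaled by `|σ₁ c|`, `‖σ₂ c‖`). [folklore] -/
theorem mul_mem_relMinima {c θ : K} (hc : c ≠ 0) (h : θ ∈ relMinima σ₁ σ₂ I) :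
    c * θ ∈ relMinima σ₁ σ₂ (FractionalIdeal.spanSingleton (𝓞 K)⁰ c * I) := by
  refine ⟨FractionalIdeal.mem_singleton_mul.mpr ⟨θ, h.1, rfl⟩, mul_ne_zero hc h.2.1,
    fun φ hφ h0 hlt => ?_⟩
  obtain ⟨ψ, hψ, rfl⟩ := FractionalIdeal.mem_singleton_mul.mp hφ
  have hψ0 : ψ ≠ 0 := fun h' => h0 (by rw [h', mul_zero])
  have hσc : 0 < |σ₁ c| := abs_pos.mpr ((map_ne_zero σ₁).mpr hc)
  have hlt' : |σ₁ ψ| < |σ₁ θ| := by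
    rw [map_mul, map_mul, abs_mul, abs_mul] at hlt
    exact lt_of_mul_lt_mul_left hlt hσc.le
  have hle := h.2.2 ψ hψ hψ0 hlt'
  rw [map_mul, map_mul, norm_mul, norm_mul]
  exact mul_le_mul_of_nonneg_left hle (norm_nonneg _)

/-- Scaling by `c` with `σ₁ c > 0` maps positive minima of `I` to positive minima of `c I`. [folklore] -/
theorem mul_mem_posRelMinima {c μ : K} (hc : 0 < σ₁ c) (h : μ ∈ posRelMinima σ₁ σ₂ I) :
    c * μ ∈ posRelMinima σ₁ σ₂ (FractionalIdeal.spanSingleton (𝓞 K)⁰ c * I) :=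
  ⟨mul_mem_relMinima ((map_ne_zero σ₁).mp hc.ne') h.1, by rw [map_mul]; exact mul_pos hc h.2⟩

/-- `c⁻¹ (c I) = I` for `c ≠ 0`. [folklore] -/
theorem spanSingleton_inv_mul_spanSingleton_mul {c : K} (hc : c ≠ 0) :
    FractionalIdeal.spanSingleton (𝓞 K)⁰ c⁻¹ * (FractionalIdeal.spanSingleton (𝓞 K)⁰ c * I) = I := by
  rw [← mul_assoc, FractionalIdeal.spanSingleton_mul_spanSingleton, inv_mul_cancel₀ hc,
    FractionalIdeal.spanSingleton_one, one_mul]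

/-- Conversely, `c⁻¹ ν` is a positive minimum of `I` for every positive minimum `ν` of `c I`
(`σ₁ c > 0`). [folklore] -/
theorem inv_mul_mem_posRelMinima {c ν : K} (hc : 0 < σ₁ c)
    (h : ν ∈ posRelMinima σ₁ σ₂ (FractionalIdeal.spanSingleton (𝓞 K)⁰ c * I)) :
    c⁻¹ * ν ∈ posRelMinima σ₁ σ₂ I := by
  have hc0 : c ≠ 0 := (map_ne_zero σ₁).mp hc.ne'
  have hci : 0 < σ₁ c⁻¹ := by rw [map_inv₀]; exact inv_pos.mpr hc
  have h' := mul_mem_posRelMinima hci h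
  rwa [spanSingleton_inv_mul_spanSingleton_mul hc0] at h'

/-- **`1` is a positive minimum of the reduced ideal `μ⁻¹ I`** for every positive minimum `μ`
of `I`. [folklore] -/
theorem one_mem_posRelMinima_inv_mul {μ : K} (hμ : μ ∈ posRelMinima σ₁ σ₂ I) :
    (1 : K) ∈ posRelMinima σ₁ σ₂ (FractionalIdeal.spanSingleton (𝓞 K)⁰ μ⁻¹ * I) := by
  have h0 : μ ≠ 0 := hμ.1.2.1
  have hc : 0 < σ₁ μ⁻¹ := by rw [map_inv₀]; exact inv_pos.mpr hμ.2
  have h := mul_mem_posRelMinima hc hμ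
  rwa [inv_mul_cancel₀ h0] at h

variable (hdeg : Module.finrank ℚ K = 3) (hσ₂ : ∃ z : K, starRingEnd ℂ (σ₂ z) ≠ σ₂ z)
  (ε : (𝓞 K)ˣ) (hε : 1 < σ₁ (algebraMap (𝓞 K) K ε))

include hdeg hσ₂ hε in
/-- **The successor commutes with scaling**: `voronoiSucc (c I) (c μ) = c · voronoiSucc I μ` for
`σ₁ c > 0` (both are the least positive minimum of `c I` above `c μ`). [folklore] -/
theorem voronoiSucc_mul {c μ : K} (hc : 0 < σ₁ c) (hμ : μ ∈ posRelMinima σ₁ σ₂ I) :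
    voronoiSucc σ₁ σ₂ (FractionalIdeal.spanSingleton (𝓞 K)⁰ c * I) (c * μ) =
      c * voronoiSucc σ₁ σ₂ I μ := by
  obtain ⟨hn, hn1, hn2⟩ := voronoiSucc_spec hdeg hσ₂ ε hε hμ
  have hcμ := mul_mem_posRelMinima hc hμ
  obtain ⟨hm, hm1, hm2⟩ := voronoiSucc_spec hdeg hσ₂ ε hε hcμ
  -- `c · voronoiSucc μ` is a positive minimum of `c I` above `c μ`
  have h1 : σ₁ (voronoiSucc σ₁ σ₂ (FractionalIdeal.spanSingleton (𝓞 K)⁰ c * I) (c * μ)) ≤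
      σ₁ (c * voronoiSucc σ₁ σ₂ I μ) :=
    hm2 _ (mul_mem_posRelMinima hc hn) (by rw [map_mul, map_mul]; exact mul_lt_mul_of_pos_left hn1 hc)
  -- `c⁻¹ · voronoiSucc (c μ)` is a positive minimum of `I` above `μ`
  have hl := inv_mul_mem_posRelMinima hc hm
  have h2' : σ₁ μ < σ₁ (c⁻¹ * voronoiSucc σ₁ σ₂ (FractionalIdeal.spanSingleton (𝓞 K)⁰ c * I) (c * μ)) := by
    rw [map_mul, map_inv₀, lt_inv_mul_iff₀ hc, ← map_mul]
    exact hm1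
  have h2 := hn2 _ hl h2'
  rw [map_mul, map_inv₀, le_inv_mul_iff₀ hc, ← map_mul] at h2
  exact σ₁.injective (le_antisymm h1 h2)

include hdeg hσ₂ hε in
/-- **Chains rescale**: the chain of `c I` through `c x₀` is `c` times the chain of `I` through `x₀`
(`σ₁ c > 0`). [folklore] -/
theorem voronoiChain_mul {c x₀ : K} (hc : 0 < σ₁ c) (hx₀ : x₀ ∈ posRelMinima σ₁ σ₂ I) (k : ℤ) :
    voronoiChain σ₁ σ₂ (FractionalIdeal.spanSingleton (𝓞 K)⁰ c * I) (c * x₀) k =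
      c * voronoiChain σ₁ σ₂ I x₀ k := by
  have hcx := mul_mem_posRelMinima hc hx₀
  induction k with
  | zero => rw [voronoiChain_zero, voronoiChain_zero]
  | succ i ih =>
    rw [voronoiChain_succ hdeg hσ₂ ε hε hcx, ih, voronoiChain_succ hdeg hσ₂ ε hε hx₀,
      voronoiSucc_mul hdeg hσ₂ ε hε hc (voronoiChain_mem hdeg hσ₂ ε hε hx₀ i)]
  | pred i ih =>
    -- the successors agree, and the successor is injective on the positive minima
    have ha := voronoiChain_mem hdeg hσ₂ ε hε hcx (-(i : ℤ) - 1)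
    have hb := mul_mem_posRelMinima hc (voronoiChain_mem hdeg hσ₂ ε hε hx₀ (-(i : ℤ) - 1))
    have key : voronoiSucc σ₁ σ₂ (FractionalIdeal.spanSingleton (𝓞 K)⁰ c * I)
        (voronoiChain σ₁ σ₂ (FractionalIdeal.spanSingleton (𝓞 K)⁰ c * I) (c * x₀) (-(i : ℤ) - 1)) =
        voronoiSucc σ₁ σ₂ (FractionalIdeal.spanSingleton (𝓞 K)⁰ c * I)
          (c * voronoiChain σ₁ σ₂ I x₀ (-(i : ℤ) - 1)) := by
      rw [← voronoiChain_succ hdeg hσ₂ ε hε hcx,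
        voronoiSucc_mul hdeg hσ₂ ε hε hc (voronoiChain_mem hdeg hσ₂ ε hε hx₀ _),
        ← voronoiChain_succ hdeg hσ₂ ε hε hx₀, show -(i : ℤ) - 1 + 1 = -i by ring, ih]
    rw [← voronoiPred_succ hdeg hσ₂ ε hε ha, key, voronoiPred_succ hdeg hσ₂ ε hε hb]

include hdeg hσ₂ hε in
/-- **Re-basing the chain**: the chain through `θ i` is `k ↦ θ (i + k)`. [folklore] -/
theorem voronoiChain_rebase {x₀ : K} (hx₀ : x₀ ∈ posRelMinima σ₁ σ₂ I) (i k : ℤ) :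
    voronoiChain σ₁ σ₂ I (voronoiChain σ₁ σ₂ I x₀ i) k = voronoiChain σ₁ σ₂ I x₀ (i + k) := by
  have hxi := voronoiChain_mem hdeg hσ₂ ε hε hx₀ i
  induction k with
  | zero => rw [voronoiChain_zero, add_zero]
  | succ k ih =>
    rw [voronoiChain_succ hdeg hσ₂ ε hε hxi, ih, ← add_assoc, voronoiChain_succ hdeg hσ₂ ε hε hx₀]
  | pred k ih =>
    have ha := voronoiChain_mem hdeg hσ₂ ε hε hxi (-(k : ℤ) - 1)
    have hb := voronoiChain_mem hdeg hσ₂ ε hε hx₀ (i + (-(k : ℤ) - 1))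
    have key : voronoiSucc σ₁ σ₂ I (voronoiChain σ₁ σ₂ I (voronoiChain σ₁ σ₂ I x₀ i) (-(k : ℤ) - 1)) =
        voronoiSucc σ₁ σ₂ I (voronoiChain σ₁ σ₂ I x₀ (i + (-(k : ℤ) - 1))) := by
      rw [← voronoiChain_succ hdeg hσ₂ ε hε hxi, ← voronoiChain_succ hdeg hσ₂ ε hε hx₀,
        show -(k : ℤ) - 1 + 1 = -k by ring, ih, show i + (-(k : ℤ) - 1) + 1 = i + -k by ring]
    rw [← voronoiPred_succ hdeg hσ₂ ε hε ha, key, voronoiPred_succ hdeg hσ₂ ε hε hb]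

include hdeg hσ₂ hε in
/-- **The chain of a reduced label**: the chain of `(θ i)⁻¹ I` through `1` is
`k ↦ (θ i)⁻¹ θ (i + k)`. [folklore] -/
theorem voronoiChain_inv_mul {x₀ : K} (hx₀ : x₀ ∈ posRelMinima σ₁ σ₂ I) (i k : ℤ) :
    voronoiChain σ₁ σ₂ (FractionalIdeal.spanSingleton (𝓞 K)⁰ (voronoiChain σ₁ σ₂ I x₀ i)⁻¹ * I) 1 k =
      (voronoiChain σ₁ σ₂ I x₀ i)⁻¹ * voronoiChain σ₁ σ₂ I x₀ (i + k) := by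
  have hxi := voronoiChain_mem hdeg hσ₂ ε hε hx₀ i
  have h0 : voronoiChain σ₁ σ₂ I x₀ i ≠ 0 := hxi.1.2.1
  have hc : 0 < σ₁ (voronoiChain σ₁ σ₂ I x₀ i)⁻¹ := by rw [map_inv₀]; exact inv_pos.mpr hxi.2
  rw [← voronoiChain_rebase hdeg hσ₂ ε hε hx₀ i k, ← voronoiChain_mul hdeg hσ₂ ε hε hc hxi k,
    inv_mul_cancel₀ h0]

omit [NumberField K] in
/-- **Iterating a one-step period**: if `θ (i + c) = u θ i` for all `i` (`u ≠ 0`), then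
`θ (i + k c) = u ^ k θ i` for all `k : ℤ`. [folklore] -/
theorem eq_zpow_mul_of_forall_apply_add {θ : ℤ → K} {u : K} (hu : u ≠ 0) {c : ℤ}
    (h : ∀ i, θ (i + c) = u * θ i) (i k : ℤ) : θ (i + k * c) = u ^ k * θ i := by
  induction k with
  | zero => simp
  | succ k ih =>
    rw [show i + ((k : ℤ) + 1) * c = (i + k * c) + c by ring, h, ih, ← mul_assoc, mul_comm u,
      zpow_add_one₀ hu]
  | pred k ih =>
    have h1 := h (i + (-(k : ℤ) - 1) * c)
    rw [show i + (-(k : ℤ) - 1) * c + c = i + (-(k : ℤ)) * c by ring, ih] at h1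
    apply mul_left_cancel₀ hu
    rw [← h1, ← mul_assoc, zpow_sub_one₀ hu, mul_comm u, mul_assoc (u ^ (-(k : ℤ))),
      inv_mul_cancel₀ hu, mul_one]

/-- **Units do not change the label**: `u I = I` for a unit `u` of `𝓞 K`. [folklore] -/
theorem spanSingleton_unit_mul (u : (𝓞 K)ˣ) :
    FractionalIdeal.spanSingleton (𝓞 K)⁰ (algebraMap (𝓞 K) K u) * I = I := by
  rw [← FractionalIdeal.coeIdeal_span_singleton, Ideal.span_singleton_eq_top.mpr u.isUnit,
    FractionalIdeal.coeIdeal_top, one_mul]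

/-- **Equality of labels**: for `b ≠ 0` and `I ≠ 0`, `a⁻¹ I = b⁻¹ I` iff `b = u a` for a unit
`u` of `𝓞 K` (cancel the invertible `I`; principal fractional ideals coincide iff the generators
differ by a unit). [folklore] -/
theorem spanSingleton_inv_mul_eq_iff (hI : I ≠ 0) {a b : K} (hb : b ≠ 0) :
    FractionalIdeal.spanSingleton (𝓞 K)⁰ a⁻¹ * I = FractionalIdeal.spanSingleton (𝓞 K)⁰ b⁻¹ * I ↔
      ∃ u : (𝓞 K)ˣ, b = algebraMap (𝓞 K) K u * a := by
  constructor
  · intro h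
    have h' : FractionalIdeal.spanSingleton (𝓞 K)⁰ a⁻¹ = FractionalIdeal.spanSingleton (𝓞 K)⁰ b⁻¹ := by
      have h2 := congrArg (· * I⁻¹) h
      simpa only [mul_assoc, mul_inv_cancel₀ hI, mul_one] using h2
    have hab : FractionalIdeal.spanSingleton (𝓞 K)⁰ a = FractionalIdeal.spanSingleton (𝓞 K)⁰ b := by
      have h3 := congrArg Inv.inv h'
      simpa only [← FractionalIdeal.spanSingleton_inv, inv_inv] using h3
    obtain ⟨z, hz⟩ := FractionalIdeal.spanSingleton_eq_spanSingleton.mp hab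
    exact ⟨z, by rw [← hz, Units.smul_def, Algebra.smul_def]⟩
  · rintro ⟨u, rfl⟩
    rw [mul_inv, ← map_units_inv, ← FractionalIdeal.spanSingleton_mul_spanSingleton, mul_assoc,
      spanSingleton_unit_mul]

end Rescale

end Literature.NumberTheory.CubicFields
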